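import Mathlib.Algebra.BigOperators.Field
import Literature.Combinatorics.StablePolynomials.Basic
import HarnessLib

/-!
# Lorentzian Frobenius bound for a stable nonnegative kernel (helper for
# `StableImpliesPairCoherence`, item stmt-AtomisticToContinuum-9675, route BECStronglyRayleigh)

For a real symmetric entrywise-nonnegative kernel `K` on a finite set with zero diagonal whose
quadratic form `Σᵢⱼ Kᵢⱼ zᵢ zⱼ` is identically zero or has no zero in the upper half-space `H^Λ`
(i.e. is Lorentzian, Brändén–Huh 2019, Prop. 1.2 / Lemma 1.5), with row sums `rₓ = Σ_y K x y` and
`R = Σₓ rₓ`: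

* `rowSum_mul_quadratic_le_sq` — the reverse Cauchy–Schwarz inequality polarised at `u = 𝟙`:
  `R · vᵀKv ≤ (r·v)²` for every real `v` (from the tree's
  `Literature.Combinatorics.StablePolynomials.four_mul_quadratic_le_sq`);
* `sum_sq_le_of_quadratic_stable` — the Frobenius bound
  `Σₓ Σ_y (K x y)² ≤ (Σₓ rₓ³)/R + (Σₓ rₓ²)²/R²`: `v = eₓ + e_y` gives `K x y ≤ (rₓ + r_y)²/(2R)`,
  `v = r` gives `rᵀKr ≤ ‖r‖⁴/R`, and summing `K² ≤ K(rₓ + r_y)²/(2R)` gives `(Σ r³ + rᵀKr)/R`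
  (Lean's `x/0 = 0` matches the case `K = 0`).

This is the analytic half of `StableImpliesPairCoherence`, applied there to the pair kernels
`K_T(x,y) = [x,y ∉ T, x ≠ y] φ(T ∪ {x,y})` of a stable multi-affine polynomial.

References: P. Brändén, J. Huh, *Lorentzian polynomials*, Ann. of Math. 192 (2020)
(arXiv:1902.03719), §1 (Prop. 1.2, Lemma 1.5). [BrandenHuh2019]
-/

noncomputable section

namespace Summit.AtomisticToContinuum.BoseEinsteinCondensation.Theorems.PairCoherence

open Finset
open scoped BigOperators

variable {Λ : Type*} [Fintype Λ]

/-- **Polarised reverse Cauchy–Schwarz at `u = 𝟙`.** For a real symmetric kernel `K` whose quadratic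
form `Σᵢⱼ Kᵢⱼ zᵢ zⱼ` has no zero in `H^Λ`, and every real `v`:
`R · vᵀKv ≤ (r·v)²` with `rᵢ = Σⱼ Kᵢⱼ`, `R = Σᵢ rᵢ` (Brändén–Huh 2019, Lemma 1.5 with `u = 𝟙 ≥ 0`).
[cite: BrandenHuh2019, §1, Lemma 1.5] -/
theorem rowSum_mul_quadratic_le_sq (K : Λ → Λ → ℝ) (hsymm : ∀ x y, K x y = K y x)
    (hK : ∀ z : Λ → ℂ, (∀ i, 0 < (z i).im) → (∑ i, ∑ j, (K i j : ℂ) * z i * z j) ≠ 0)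
    (v : Λ → ℝ) :
    (∑ i, ∑ j, K i j) * (∑ i, ∑ j, K i j * v i * v j) ≤ (∑ i, (∑ j, K i j) * v i) ^ 2 := by
  have h := Literature.Combinatorics.StablePolynomials.four_mul_quadratic_le_sq K hK (fun _ => 1) v
    (fun _ => zero_le_one)
  have e1 : (∑ i, ∑ j, K i j * (1 : ℝ) * 1) = ∑ i, ∑ j, K i j := by simp
  have e2 : (∑ i, ∑ j, K i j * (1 * v j + v i * 1)) = 2 * ∑ i, (∑ j, K i j) * v i := by
    have h1 : (∑ i, ∑ j, K i j * v i) = ∑ i, (∑ j, K i j) * v i := by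
      refine Finset.sum_congr rfl fun i _ => ?_
      rw [Finset.sum_mul]
    have h2 : (∑ i, ∑ j, K i j * v j) = ∑ i, (∑ j, K i j) * v i := by
      rw [Finset.sum_comm]
      refine Finset.sum_congr rfl fun j _ => ?_
      rw [Finset.sum_mul]
      exact Finset.sum_congr rfl fun i _ => by rw [hsymm i j]
    simp only [one_mul, mul_one, mul_add, Finset.sum_add_distrib]
    rw [h1, h2]
    ring
  rw [e1, e2] at h
  nlinarith [h]

/-- **Lorentzian Frobenius bound.** For a real symmetric entrywise-nonnegative kernel `K` with zero
diagonal whose quadratic form is identically zero or has no zero in `H^Λ`, with row sums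
`rₓ = Σ_y K x y` and `R = Σₓ rₓ`:
`Σₓ Σ_y (K x y)² ≤ (Σₓ rₓ³)/R + (Σₓ rₓ²)²/R²` (Lean's `x/0 = 0` matches the case `K = 0`).
Reverse Cauchy–Schwarz with `v = eₓ + e_y` gives `K x y ≤ (rₓ + r_y)²/(2R)`, with `v = r` gives
`rᵀKr ≤ ‖r‖⁴/R`; summing `K² ≤ K (rₓ+r_y)²/(2R)` gives `(Σ r³ + rᵀKr)/R`.
[cite: BrandenHuh2019, §1, Prop. 1.2 and Lemma 1.5] -/
theorem sum_sq_le_of_quadratic_stable (K : Λ → Λ → ℝ) (hsymm : ∀ x y, K x y = K y x)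
    (hnn : ∀ x y, 0 ≤ K x y) (hdiag : ∀ x, K x x = 0)
    (hK : (∀ x y, K x y = 0) ∨
      ∀ z : Λ → ℂ, (∀ i, 0 < (z i).im) → (∑ i, ∑ j, (K i j : ℂ) * z i * z j) ≠ 0) :
    ∑ x, ∑ y, K x y ^ 2 ≤
      (∑ x, (∑ y, K x y) ^ 3) / (∑ x, ∑ y, K x y) +
        (∑ x, (∑ y, K x y) ^ 2) ^ 2 / (∑ x, ∑ y, K x y) ^ 2 := by
  classical
  set r : Λ → ℝ := fun x => ∑ y, K x y with hr
  have hr' : ∀ x, (∑ y, K x y) = r x := fun x => rfl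
  simp only [hr']
  set R : ℝ := ∑ x, r x with hR
  have hrnn : ∀ x, 0 ≤ r x := fun x => Finset.sum_nonneg fun y _ => hnn x y
  have hRnn : 0 ≤ R := Finset.sum_nonneg fun x _ => hrnn x
  by_cases hR0 : R = 0
  · -- then every row sum vanishes, hence `K = 0`
    have hr0 : ∀ x, r x = 0 := fun x =>
      (Finset.sum_eq_zero_iff_of_nonneg (fun x _ => hrnn x)).1 hR0 x (Finset.mem_univ x)
    have hK0 : ∀ x y, K x y = 0 := fun x y =>
      (Finset.sum_eq_zero_iff_of_nonneg (fun y _ => hnn x y)).1 (hr0 x) y (Finset.mem_univ y)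
    simp [hK0, hr0]
  have hRpos : 0 < R := lt_of_le_of_ne hRnn (Ne.symm hR0)
  -- the quadratic form is stable (the zero alternative contradicts `R ≠ 0`)
  have hst : ∀ z : Λ → ℂ, (∀ i, 0 < (z i).im) → (∑ i, ∑ j, (K i j : ℂ) * z i * z j) ≠ 0 := by
    rcases hK with h0 | h
    · exact absurd (by simp [hR, hr, h0]) hR0
    · exact h
  have hcs := rowSum_mul_quadratic_le_sq K hsymm hst
  simp only [hr'] at hcs
  -- (a) entrywise bound `2 R K x y ≤ (r x + r y)²` for `x ≠ y`
  have hpair : ∀ x y, x ≠ y → 2 * R * K x y ≤ (r x + r y) ^ 2 := by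
    intro x y hxy
    have h := hcs (fun i => (if i = x then 1 else 0) + (if i = y then 1 else 0))
    have eQ : (∑ i, ∑ j, K i j * ((if i = x then 1 else 0) + (if i = y then 1 else 0)) *
        ((if j = x then 1 else 0) + (if j = y then 1 else 0))) = 2 * K x y := by
      simp only [mul_add, mul_ite, mul_one, mul_zero, Finset.sum_add_distrib,
        Finset.sum_ite_eq', Finset.mem_univ, if_true]
      simp only [hdiag, hsymm y x]
      ring
    have eL : (∑ i, r i * ((if i = x then 1 else 0) + (if i = y then 1 else 0))) = r x + r y := by
      simp only [mul_add, mul_ite, mul_one, mul_zero, Finset.sum_add_distrib, Finset.sum_ite_eq',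
        Finset.mem_univ, if_true]
    rw [eQ, eL, ← hR] at h
    linarith
  -- (b) `R · rᵀKr ≤ (Σ r²)²`
  have hrr : R * (∑ i, ∑ j, K i j * r i * r j) ≤ (∑ i, r i ^ 2) ^ 2 := by
    have h := hcs r
    rw [← hR] at h
    simpa [sq] using h
  -- summing (a): `Σ K² ≤ (Σ r³ + rᵀKr)/R`
  have hsum : ∑ x, ∑ y, K x y ^ 2 ≤ ((∑ x, r x ^ 3) + ∑ i, ∑ j, K i j * r i * r j) / R := by
    have step : ∀ x y, K x y ^ 2 ≤ K x y * (r x + r y) ^ 2 / (2 * R) := by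
      intro x y
      by_cases hxy : x = y
      · subst hxy
        simp [hdiag]
      · have h1 : K x y ≤ (r x + r y) ^ 2 / (2 * R) := by
          rw [le_div_iff₀ (by positivity)]
          linarith [hpair x y hxy]
        calc K x y ^ 2 = K x y * K x y := sq _
          _ ≤ K x y * ((r x + r y) ^ 2 / (2 * R)) := mul_le_mul_of_nonneg_left h1 (hnn x y)
          _ = K x y * (r x + r y) ^ 2 / (2 * R) := (mul_div_assoc _ _ _).symm
    have h2 : ∑ x, ∑ y, K x y * (r x + r y) ^ 2 / (2 * R) =
        ((∑ x, r x ^ 3) + ∑ i, ∑ j, K i j * r i * r j) / R := by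
      have e3 : ∑ x, ∑ y, K x y * r x ^ 2 = ∑ x, r x ^ 3 := by
        refine Finset.sum_congr rfl fun x _ => ?_
        rw [← Finset.sum_mul, hr' x]
        ring
      have e4 : ∑ x, ∑ y, K x y * r y ^ 2 = ∑ x, r x ^ 3 := by
        rw [Finset.sum_comm]
        refine Finset.sum_congr rfl fun y _ => ?_
        rw [show (∑ x, K x y * r y ^ 2) = (∑ x, K y x) * r y ^ 2 by
          rw [Finset.sum_mul]; exact Finset.sum_congr rfl fun x _ => by rw [hsymm x y]]
        rw [hr' y]
        ring
      have e5 : ∑ x, ∑ y, K x y * (r x + r y) ^ 2 =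
          2 * (∑ x, r x ^ 3) + 2 * ∑ i, ∑ j, K i j * r i * r j := by
        have : ∀ x y, K x y * (r x + r y) ^ 2 =
            K x y * r x ^ 2 + 2 * (K x y * r x * r y) + K x y * r y ^ 2 := fun x y => by ring
        simp only [this, Finset.sum_add_distrib, ← Finset.mul_sum]
        rw [e3, e4]
        ring
      simp only [← Finset.sum_div]
      rw [e5, div_eq_div_iff (by positivity) hR0]
      ring
    calc ∑ x, ∑ y, K x y ^ 2 ≤ ∑ x, ∑ y, K x y * (r x + r y) ^ 2 / (2 * R) :=
          Finset.sum_le_sum fun x _ => Finset.sum_le_sum fun y _ => step x y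
      _ = _ := h2
  -- combine with (b)
  calc ∑ x, ∑ y, K x y ^ 2 ≤ ((∑ x, r x ^ 3) + ∑ i, ∑ j, K i j * r i * r j) / R := hsum
    _ = (∑ x, r x ^ 3) / R + (∑ i, ∑ j, K i j * r i * r j) / R := add_div _ _ _
    _ ≤ (∑ x, r x ^ 3) / R + ((∑ i, r i ^ 2) ^ 2 / R) / R := by
        gcongr
        rw [le_div_iff₀ hRpos]
        linarith [hrr]
    _ = (∑ x, r x ^ 3) / R + (∑ x, r x ^ 2) ^ 2 / R ^ 2 := by rw [div_div, sq R]

end Summit.AtomisticToContinuum.BoseEinsteinCondensation.Theorems.PairCoherence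

end
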